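import Summits.AtomisticToContinuum.HydrodynamicLimit.Theorems.AntiMazurCoboundariesInfluenceLocalityObjects
import Literature.Analysis.FluidPDE.HardSphereDynamicsProofs
import Literature.Analysis.FluidPDE.HardSphereMomentumConservation
import Literature.MathematicalPhysics.KineticTheory.BackwardClusterMeasurable

/-!
# Energy domination along backward clusters (stub `stub_energyDomination` of the line
# `true-anchored-infection`, crux `InfluenceLocality`, stmt-AtomisticToContinuum-13916)

Registered stub S2 of the skeleton `Cruxes/InfluenceLocality/Lines/true_anchored_infection.lean`
(objects module `AntiMazurCoboundariesInfluenceLocalityObjects`): the deterministic lever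
`EnergyDomination` — along any hard-sphere trajectory `γ` on `𝕋³` and for any reference velocity
`c`, the kinetic energy of a particle `m` relative to `c` at a time `t ≥ 0` is at most the INITIAL
relative kinetic energy of `m` together with its backward cluster over `(0, t]`
(`KineticTheory.backwardCluster`, Aoki–Pulvirenti–Simonella–Tsuji 2015 §5):
`‖v_m(t) − c‖² ≤ ∑_{a ∈ {m} ∪ BC(m)} ‖v_a(0) − c‖²`.

## Proof

We prove the statement for RUNNING clusters: for every finset `S` of particles,
`∑_{a ∈ S} ‖v_a(t) − c‖² ≤ ∑_{a ∈ (sweep (collisionEvents γ s t) (S, 0)).1} ‖v_a(s) − c‖²`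
(`sum_norm_sq_le_sum_sweep`), by induction on the number of collision times in the window
`(s, t]`; the stub is the case `S = {m}`, `s = 0` (`backwardSweep_fst_eq_insert`).

* No collision in `(s, t]`: the motion is free flight (`IsHardSphereTrajectory.vel_eq_of_free`),
  velocities do not change and the sweep is empty — equality.
* Otherwise let `τ` be the LAST collision time in `(s, t]`, of the pair `{p, q}`
  (`IsHardSphereTrajectory.contactPairSet_eq_singleton`). On `(τ, t]` the velocities are those at
  `τ` (free flight); `γ τ = collidePair p q zl` where the left limit `zl` has the velocities of
  `γ σ` for any `σ < τ` with `(σ, τ)` collision-free (`exists_eq_collidePair_of_Ioo_free`, via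
  `IsHardSphereTrajectory.vel_eq_of_tendsto` of `KineticTheory/BackwardClusterMeasurable.lean`).
  The ONE-STEP INEQUALITY
  `∑_{a ∈ S} ‖(collidePair p q zl a).2 − c‖² ≤ ∑_{a ∈ clusterStep {{p,q}} S} ‖(zl a).2 − c‖²`
  (`sum_collidePair_le`) follows from the PAIR IDENTITY
  `‖v' − c‖² + ‖w' − c‖² = ‖v − c‖² + ‖w − c‖²` for an elastic reflection (momentum + energy
  conservation: the reflection commutes with the shift by `c`, `reflectVel_sub_const`): if one of
  `p, q` belongs to `S` both belong to the new cluster `S ∪ {p, q}` and the sum over the larger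
  set of the post-collisional energies dominates, then equals the pre-collisional one; if neither
  does, nothing changes. Finally the window `(s, σ]` has one collision time less, the events over
  `(s, t]` are those over `(s, σ]` followed by `{{p, q}}` (`collisionEvents_eq_append`), and
  `sweep (L ++ [E]) (S, 0)` has the running cluster of `sweep L (clusterStep E S, 0)`; the
  induction hypothesis at `σ` with the running cluster `clusterStep {{p, q}} S` concludes.

Trajectories are right-continuous (`γ τ` is post-collisional) and the window is `(0, t]`: a
collision AT time `0` is not processed, consistently with `v_a(0)` being the time-`0` value.
No named fact is used; everything rests on the `IsHardSphereTrajectory` fields and the vendored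
backward-cluster bookkeeping of `KineticTheory/BackwardCluster.lean` and the velocity lemmas of
`KineticTheory/BackwardClusterMeasurable.lean`.
-/

namespace Summit.AtomisticToContinuum.HydrodynamicLimit.Theorems.TrueAnchoredInfection

open Set Filter
open scoped Topology
open Literature.Analysis.FluidPDE Literature.MathematicalPhysics.KineticTheory

noncomputable section

/-! ## The pair identity of an elastic reflection -/

section Reflect

variable {E : Type*} [NormedAddCommGroup E] [InnerProductSpace ℝ E]

/-- Shifting both velocities by the same vector `c` commutes with the elastic reflection (the law
only sees the relative velocity `v − w`). -/
theorem reflectVel_sub_const (n c : E) (p : E × E) :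
    reflectVel n (p.1 - c, p.2 - c) = ((reflectVel n p).1 - c, (reflectVel n p).2 - c) := by
  simp only [reflectVel, sub_sub_sub_cancel_right, Prod.mk.injEq]
  constructor <;> abel

/-- PAIR IDENTITY: an elastic reflection conserves the kinetic energy of the pair relative to any
reference velocity `c`, `‖v' − c‖² + ‖w' − c‖² = ‖v − c‖² + ‖w − c‖²` (conservation of momentum
and energy, `reflectVel_fst_add_reflectVel_snd` /
`norm_sq_reflectVel_fst_add_norm_sq_reflectVel_snd`, here obtained at once from the latter applied
to the shifted pair). -/
theorem norm_sq_reflectVel_sub_add (n c : E) (p : E × E) :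
    ‖(reflectVel n p).1 - c‖ ^ 2 + ‖(reflectVel n p).2 - c‖ ^ 2 =
      ‖p.1 - c‖ ^ 2 + ‖p.2 - c‖ ^ 2 := by
  have h := norm_sq_reflectVel_fst_add_norm_sq_reflectVel_snd n (p.1 - c, p.2 - c)
  rwa [reflectVel_sub_const] at h

end Reflect

/-! ## Sums over a finset through a binary collision -/

section Sums

variable {ι : Type*} [DecidableEq ι]

/-- Two sums over a finset containing `p ≠ q` agree if the summands have the same two-term sum on
`{p, q}` and agree at every other element of the finset. -/
theorem sum_eq_sum_of_pair {T : Finset ι} {p q : ι} (hpq : p ≠ q) (hp : p ∈ T) (hq : q ∈ T)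
    {f g : ι → ℝ} (hfg : f p + f q = g p + g q) (h : ∀ a ∈ T, a ≠ p → a ≠ q → f a = g a) :
    ∑ a ∈ T, f a = ∑ a ∈ T, g a := by
  have hq' : q ∈ T.erase p := Finset.mem_erase.2 ⟨hpq.symm, hq⟩
  rw [← Finset.add_sum_erase T f hp, ← Finset.add_sum_erase _ f hq',
    ← Finset.add_sum_erase T g hp, ← Finset.add_sum_erase _ g hq', ← add_assoc, ← add_assoc, hfg]
  congr 1
  refine Finset.sum_congr rfl fun a ha => ?_
  simp only [Finset.mem_erase] at ha
  exact h a ha.2.2 ha.2.1 ha.1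

end Sums

section Cluster

variable {k : ℕ}

/-- The backward step over a single pair one of whose members already belongs to the running
cluster: both members belong to the new running cluster. -/
theorem clusterStep_singleton_of_mem {p q : Fin k} {S : Finset (Fin k)} (h : p ∈ S ∨ q ∈ S) :
    clusterStep {s(p, q)} S = S ∪ {p, q} := by
  ext a
  rw [mem_clusterStep, Finset.mem_union, Finset.mem_insert, Finset.mem_singleton]
  constructor
  · rintro (ha | ⟨j, hj, hja⟩)
    · exact Or.inl ha
    · rcases Sym2.eq_iff.1 (Finset.mem_singleton.1 hja) with ⟨-, rfl⟩ | ⟨-, rfl⟩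
      · exact Or.inr (Or.inr rfl)
      · exact Or.inr (Or.inl rfl)
  · rintro (ha | rfl | rfl)
    · exact Or.inl ha
    · rcases h with hp | hq
      · exact Or.inl hp
      · exact Or.inr ⟨q, hq, Finset.mem_singleton.2 Sym2.eq_swap⟩
    · rcases h with hp | hq
      · exact Or.inr ⟨p, hp, Finset.mem_singleton.2 rfl⟩
      · exact Or.inl hq

/-- The backward step over a single pair none of whose members belongs to the running cluster
changes nothing. -/
theorem clusterStep_singleton_of_not_mem {p q : Fin k} {S : Finset (Fin k)} (hp : p ∉ S)
    (hq : q ∉ S) : clusterStep {s(p, q)} S = S := by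
  refine Finset.Subset.antisymm (fun a ha => ?_) (subset_clusterStep _ _)
  rcases mem_clusterStep.1 ha with ha | ⟨j, hj, hja⟩
  · exact ha
  · rcases Sym2.eq_iff.1 (Finset.mem_singleton.1 hja) with ⟨rfl, -⟩ | ⟨rfl, -⟩
    · exact absurd hj hp
    · exact absurd hj hq

/-- The running cluster of a sweep does not depend on the initial recollision count. -/
theorem sweep_fst_eq (Es : List (Finset (Sym2 (Fin k)))) (S : Finset (Fin k)) (r : ℕ) :
    (sweep Es (S, r)).1 = (sweep Es (S, 0)).1 := by
  induction Es with
  | nil => rfl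
  | cons E Es ih => simp only [sweep_cons, sweepStep, ih]

/-- Sweeping over `Es ++ [E]` from `S`: the running cluster is that of the sweep over `Es` from
`clusterStep E S` (the last event is processed first). -/
theorem sweep_append_singleton_fst (Es : List (Finset (Sym2 (Fin k)))) (E : Finset (Sym2 (Fin k)))
    (S : Finset (Fin k)) : (sweep (Es ++ [E]) (S, 0)).1 = (sweep Es (clusterStep E S, 0)).1 := by
  simp only [sweep_append, sweep_cons, sweep_nil, sweepStep, zero_add]
  exact sweep_fst_eq Es (clusterStep E S) _

variable {d : Type*} [Fintype d] {X : Type*}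

/-- ONE-STEP INEQUALITY: after the elastic collision of the pair `(p, q)` the kinetic energy
relative to `c` carried by a running cluster `S` is at most the PRE-collisional relative kinetic
energy carried by the running cluster after the backward step over the event `{{p, q}}`. If one
of `p, q` belongs to `S` both belong to `clusterStep {{p, q}} S = S ∪ {p, q}`, the sum of the
(nonnegative) post-collisional energies over the larger set dominates and equals the
pre-collisional one by the pair identity; if neither does, the step and the collision change
nothing on `S`. -/
theorem sum_collidePair_le (G : Geometry d X) {p q : Fin k} (hpq : p ≠ q) (zl : Config k d X)
    (c : EuclideanSpace ℝ d) (S : Finset (Fin k)) :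
    ∑ a ∈ S, ‖(collidePair G p q zl a).2 - c‖ ^ 2 ≤
      ∑ a ∈ clusterStep {s(p, q)} S, ‖(zl a).2 - c‖ ^ 2 := by
  by_cases hS : p ∈ S ∨ q ∈ S
  · rw [clusterStep_singleton_of_mem hS]
    calc ∑ a ∈ S, ‖(collidePair G p q zl a).2 - c‖ ^ 2
        ≤ ∑ a ∈ S ∪ {p, q}, ‖(collidePair G p q zl a).2 - c‖ ^ 2 :=
          Finset.sum_le_sum_of_subset_of_nonneg Finset.subset_union_left fun _ _ _ => sq_nonneg _
      _ = ∑ a ∈ S ∪ {p, q}, ‖(zl a).2 - c‖ ^ 2 := by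
          refine sum_eq_sum_of_pair hpq (by simp) (by simp) ?_ fun a _ hap haq => by
            rw [collidePair_apply_of_ne hap haq]
          rw [collidePair_apply_left hpq, collidePair_apply_right]
          exact norm_sq_reflectVel_sub_add _ c _
  · rw [not_or] at hS
    rw [clusterStep_singleton_of_not_mem hS.1 hS.2]
    refine (Finset.sum_congr rfl fun a ha => ?_).le
    rw [collidePair_apply_of_ne (ne_of_mem_of_not_mem ha hS.1) (ne_of_mem_of_not_mem ha hS.2)]

end Cluster

/-! ## Along a hard-sphere trajectory -/

section Trajectory

variable {d : Type*} [Fintype d] {X : Type*} [TopologicalSpace X] {N : ℕ} {G : Geometry d X}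
  {ε : ℝ} {γ : ℝ → Config N d X}

/-- At a contact of the pair `(p, q)` at time `t`, the value `γ t` is the elastic collision of
`(p, q)` in a configuration whose velocities are those of `γ σ`, for any `σ < t` with `(σ, t)`
collision-free (the left limit of `IsHardSphereTrajectory.binary`, whose velocities are those
at time `σ`: `IsHardSphereTrajectory.vel_eq_of_tendsto` — velocities are constant on `[σ, t)`
and limits in `ℝ^d` are unique). -/
theorem exists_eq_collidePair_of_Ioo_free (h : IsHardSphereTrajectory G ε N γ) {σ t : ℝ}
    (hσt : σ < t) (hfree : ∀ τ ∈ Ioo σ t, τ ∉ collisionTimes G ε γ) {p q : Fin N}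
    (hpq : p ≠ q) (hc : γ t ∈ contactSet G N ε p q) :
    ∃ zl : Config N d X, γ t = collidePair G p q zl ∧ ∀ a, (zl a).2 = (γ σ a).2 := by
  obtain ⟨-, zl, hzl, -, heq⟩ := h.binary t p q hpq hc
  exact ⟨zl, heq, h.vel_eq_of_tendsto hσt hfree hzl⟩

/-- With no collision in `(s, t]` the velocities at `t` are those at `s` and the sweep is empty:
the running-cluster energy inequality is an equality. -/
theorem sum_eq_sum_sweep_of_window_eq_empty (h : IsHardSphereTrajectory G ε N γ) {s t : ℝ}
    (hst : s ≤ t) (hW : collisionWindow G ε γ s t = ∅) (c : EuclideanSpace ℝ d)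
    (S : Finset (Fin N)) :
    ∑ a ∈ S, ‖(γ t a).2 - c‖ ^ 2 =
      ∑ a ∈ (sweep (collisionEvents G ε γ s t) (S, 0)).1, ‖(γ s a).2 - c‖ ^ 2 := by
  have hfree : ∀ τ ∈ Ioc s t, τ ∉ collisionTimes G ε γ := by
    intro τ hτ hcol
    have hmem : τ ∈ collisionWindow G ε γ s t := h.mem_collisionWindow.2 ⟨hcol, hτ⟩
    rw [hW] at hmem
    exact Finset.notMem_empty τ hmem
  simp only [collisionEvents, hW, Finset.sort_empty, List.map_nil, sweep_nil,
    h.vel_eq_of_free hst hfree]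

/-- PEELING OFF THE LAST COLLISION of a nonempty window `(s, t]`: there are a time `σ ∈ [s, τ)`
before the last collision time `τ ≤ t`, of the pair `(p, q)`, with `(σ, τ)` and `(τ, t]`
collision-free, strictly fewer collision times in `(s, σ]`, and the events over `(s, t]` are
those over `(s, σ]` followed by the single event `{{p, q}}`. -/
theorem exists_peel_last_collision (h : IsHardSphereTrajectory G ε N γ) {s t : ℝ}
    (hW : (collisionWindow G ε γ s t).Nonempty) :
    ∃ σ τ : ℝ, ∃ p q : Fin N, s ≤ σ ∧ σ < τ ∧ τ ≤ t ∧ p ≠ q ∧ γ τ ∈ contactSet G N ε p q ∧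
      (∀ τ' ∈ Ioo σ τ, τ' ∉ collisionTimes G ε γ) ∧
      (∀ τ' ∈ Ioc τ t, τ' ∉ collisionTimes G ε γ) ∧
      (collisionWindow G ε γ s σ).card < (collisionWindow G ε γ s t).card ∧
      collisionEvents G ε γ s t = collisionEvents G ε γ s σ ++ [{s(p, q)}] := by
  obtain ⟨τ, hτmem, hτmax⟩ : ∃ τ ∈ collisionWindow G ε γ s t,
      ∀ τ' ∈ collisionWindow G ε γ s t, τ' ≤ τ :=
    ⟨_, Finset.max'_mem _ hW, fun τ' h' => Finset.le_max' _ τ' h'⟩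
  obtain ⟨hτcol, hsτ, hτt⟩ := h.mem_collisionWindow.1 hτmem
  obtain ⟨p, q, hpq, hc⟩ := mem_collisionTimes.1 hτcol
  obtain ⟨s', hs'τ, hfree'⟩ := h.exists_Ioo_left_free τ
  obtain ⟨σ, hsσ, hs'σ, hστ⟩ : ∃ σ, s ≤ σ ∧ s' ≤ σ ∧ σ < τ :=
    ⟨max s' s, le_max_right _ _, le_max_left _ _, max_lt hs'τ hsτ⟩
  have hfreeL : ∀ τ' ∈ Ioo σ τ, τ' ∉ collisionTimes G ε γ :=
    fun τ' hτ' => hfree' τ' ⟨hs'σ.trans_lt hτ'.1, hτ'.2⟩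
  have hfreeR : ∀ τ' ∈ Ioc τ t, τ' ∉ collisionTimes G ε γ := fun τ' hτ' hcol =>
    (not_lt.2 (hτmax τ' (h.mem_collisionWindow.2 ⟨hcol, hsτ.trans hτ'.1, hτ'.2⟩))) hτ'.1
  have hσt : σ ≤ t := hστ.le.trans hτt
  have hfin : (collisionTimes G ε γ ∩ Ioc s t).Finite :=
    (h.locFinite s t).subset (inter_subset_inter_right _ Ioc_subset_Icc_self)
  have hWσ : collisionWindow G ε γ σ t = {τ} := by
    ext τ'
    rw [h.mem_collisionWindow, Finset.mem_singleton]
    constructor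
    · rintro ⟨hcol, hστ', hτ't⟩
      by_contra hne
      rcases lt_or_gt_of_ne hne with hlt | hgt
      · exact hfreeL τ' ⟨hστ', hlt⟩ hcol
      · exact hfreeR τ' ⟨hgt, hτ't⟩ hcol
    · rintro rfl
      exact ⟨hτcol, hστ, hτt⟩
  have hunion := collisionWindow_eq_union hsσ hσt hfin
  rw [hWσ] at hunion
  have hτnot : τ ∉ collisionWindow G ε γ s σ := fun hmem =>
    (not_le.2 hστ) (h.mem_collisionWindow.1 hmem).2.2
  refine ⟨σ, τ, p, q, hsσ, hστ, hτt, hpq, hc, hfreeL, hfreeR, ?_, ?_⟩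
  · rw [hunion, Finset.union_comm, ← Finset.insert_eq, Finset.card_insert_of_notMem hτnot]
    exact Nat.lt_succ_self _
  · rw [collisionEvents_eq_append hsσ hσt hfin]
    congr 1
    simp only [collisionEvents, hWσ, Finset.sort_singleton, List.map_cons, List.map_nil,
      h.contactPairSet_eq_singleton hpq hc]

/-- ENERGY DOMINATION FOR RUNNING CLUSTERS: for every finset `S` of particles and `s ≤ t`, the
kinetic energy relative to `c` carried by `S` at time `t` is at most the relative kinetic energy
at time `s` carried by the running cluster of the backward sweep of `S` over the collisions in
`(s, t]`. By induction on the number `n` of collision times in the window, peeling off the last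
collision (`exists_peel_last_collision`, `sum_collidePair_le`). -/
theorem sum_norm_sq_le_sum_sweep (h : IsHardSphereTrajectory G ε N γ) (c : EuclideanSpace ℝ d)
    (s : ℝ) (n : ℕ) :
    ∀ t : ℝ, s ≤ t → (collisionWindow G ε γ s t).card ≤ n → ∀ S : Finset (Fin N),
      ∑ a ∈ S, ‖(γ t a).2 - c‖ ^ 2 ≤
        ∑ a ∈ (sweep (collisionEvents G ε γ s t) (S, 0)).1, ‖(γ s a).2 - c‖ ^ 2 := by
  induction n with
  | zero =>
    intro t hst hcard S
    exact (sum_eq_sum_sweep_of_window_eq_empty h hst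
      (Finset.card_eq_zero.1 (Nat.le_zero.1 hcard)) c S).le
  | succ n ih =>
    intro t hst hcard S
    rcases (collisionWindow G ε γ s t).eq_empty_or_nonempty with hW | hW
    · exact (sum_eq_sum_sweep_of_window_eq_empty h hst hW c S).le
    obtain ⟨σ, τ, p, q, hsσ, hστ, hτt, hpq, hc, hfreeL, hfreeR, hlt, hev⟩ :=
      exists_peel_last_collision h hW
    obtain ⟨zl, hzeq, hzl⟩ := exists_eq_collidePair_of_Ioo_free h hστ hfreeL hpq hc
    calc ∑ a ∈ S, ‖(γ t a).2 - c‖ ^ 2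
        = ∑ a ∈ S, ‖(collidePair G p q zl a).2 - c‖ ^ 2 := by
          simp only [h.vel_eq_of_free hτt hfreeR, hzeq]
      _ ≤ ∑ a ∈ clusterStep {s(p, q)} S, ‖(zl a).2 - c‖ ^ 2 := sum_collidePair_le G hpq zl c S
      _ = ∑ a ∈ clusterStep {s(p, q)} S, ‖(γ σ a).2 - c‖ ^ 2 := by simp only [hzl]
      _ ≤ ∑ a ∈ (sweep (collisionEvents G ε γ s σ) (clusterStep {s(p, q)} S, 0)).1,
            ‖(γ s a).2 - c‖ ^ 2 := ih σ hsσ (by omega) _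
      _ = ∑ a ∈ (sweep (collisionEvents G ε γ s t) (S, 0)).1, ‖(γ s a).2 - c‖ ^ 2 := by
          rw [hev, sweep_append_singleton_fst]

end Trajectory

/-! ## The registered stub -/

/-- **Registered stub S2 `stub_energyDomination`** of the line `true-anchored-infection`
(crux stmt-AtomisticToContinuum-13916), lever (ii) ENERGY DOMINATION: along any hard-sphere
trajectory on `𝕋³` and for any reference velocity `c`, the kinetic energy of a particle relative
to `c` at time `t ≥ 0` is at most the initial relative kinetic energy of itself plus its backward
cluster over `(0, t]`. The case `S = {m}`, `s = 0` of `sum_norm_sq_le_sum_sweep`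
(`backwardSweep_fst_eq_insert`: the running cluster of the backward sweep of `{m}` is
`{m} ∪ BC(m)`). -/
theorem stub_energyDomination : EnergyDomination := by
  intro k ε γ h c m t ht
  have key := sum_norm_sq_le_sum_sweep h c 0 _ t ht le_rfl {m}
  rw [Finset.sum_singleton] at key
  rw [← backwardSweep_fst_eq_insert]
  exact key

end

end Summit.AtomisticToContinuum.HydrodynamicLimit.Theorems.TrueAnchoredInfection
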